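import Literature.AlgebraicGeometry.Modules.WedgeTransition
import Literature.AlgebraicGeometry.Modules.SectionNormalisedIso
import Literature.AlgebraicGeometry.Modules.SectionRigidificationTransport
import HarnessLib

/-!
# Transition functions of normalised isomorphisms between rigidified rank-one families over one test object

Layer `Literature/AlgebraicGeometry/Modules`, namespace `Literature.AlgebraicGeometry.Modules`.
THEOREMS ONLY (no definition, no named fact, no instance).

File 3a of the (Z1-sec) programme «the rigidified rank-one functor is a Zariski sheaf on the base»
([BoschLutkebohmertRaynaud1990, §8.1 Prop. 4]; [MumfordAV1970, §13 p. 125]).  A TEST OBJECT is `p : X_T ⟶ T` with a section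
`e_T` and `p^♯` surjective on global functions (Stein); a CHART is `(X_k, L_k, ec_k : B_k ⟶ X_k, r_k : ec_k^*L_k ≅ 𝒪)` (a
rank-one module rigidified along a section); a chart is READ ON THE TEST OBJECT through `m_k : X_T ⟶ X_k` over
`β_k : T ⟶ B_k` with the square `e_T ≫ m_k = β_k ≫ ec_k`, the rigidification of `m_k^*L_k` along `e_T` being the TRANSPORT of
`r_k` (the chain of ★ `Modules/SectionNormalisedIso` §4).  Between two charts read on the same test object there is THE
normalised isomorphism `Ψ : m₁^*L₁ ≅ m₂^*L₂` (★ `existsUnique_iso_normalised`), and for frames `e₁`, `e₂` of `L₁`, `L₂` the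
PAIR TRANSITION FUNCTION is the wedge transition function of ★ `Modules/WedgeTransition`:
`transitionDet (pullbackFrame m₁ e₁ ≪≫ Ψ|) (pullbackFrame m₂ e₂)`.  This file proves its calculus:

* `transitionDet_pair_mul` — three charts on one test object: the pair transition functions MULTIPLY (the three
  normalised isomorphisms compose, ★ `iso_trans_eq_of_normalised`; any rigidifications);
* `transitionDet_pair_self` — one chart read twice through the same map: the pair transition function of two frames is
  `m^♯ det T(e, e')` (the normalised automorphism is `𝟙`);
* `transitionDet_pair_baseChange` — BASE CHANGE along a morphism of test objects `g : X_{T'} ⟶ X_T` over `t : T' ⟶ T`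
  (square of sections `e_{T'} ≫ g = t ≫ e_T`): `g^♯` of the pair transition function on `T` is the pair transition function on
  `T'` for the charts read through `g ≫ m_k` with their DIRECTLY transported rigidifications — the one place where the
  functoriality of transport (★ `transport_comp`) and its stability (★ `pullback_map_normalised`) are used;
* `transitionDet_pair_congr` — the pair transition function depends only on the reading maps (propositionally).

Everything is proved; no named facts.

## References
* [BoschLutkebohmertRaynaud1990] S. Bosch, W. Lütkebohmert, M. Raynaud, *Néron Models* (1990), §8.1 Prop. 4.
* [MumfordAV1970] D. Mumford, *Abelian Varieties* (1970), §13 (proof of the Thm. p. 125).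
* [StacksProject] The Stacks Project, Tag 04TP (glueing sheaves of modules).
-/

noncomputable section

-- `Scheme.Modules` / `SheafOfModules` are not reducible (as in Mathlib's `AlgebraicGeometry/Modules/Sheaf.lean`).
set_option backward.isDefEq.respectTransparency false

open CategoryTheory AlgebraicGeometry Opposite TopologicalSpace

universe u

namespace Literature.AlgebraicGeometry.Modules

open Literature.AlgebraicGeometry.Motives

section OneTestObject

variable {XT T X₁ X₂ X₃ : Scheme.{u}} (p : XT ⟶ T) (eT : T ⟶ XT) (heT : eT ≫ p = 𝟙 T)
  {L₁ : X₁.Modules} {L₂ : X₂.Modules} {L₃ : X₃.Modules} (m₁ : XT ⟶ X₁) (m₂ : XT ⟶ X₂) (m₃ : XT ⟶ X₃)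
  {U₁ : X₁.Opens} {U₂ : X₂.Opens} {U₃ : X₃.Opens} {I₁ I₂ I₃ : Type u} [Fintype I₁] [Fintype I₂] [Fintype I₃]
  (e₁ : SheafOfModules.free I₁ ≅ L₁.over U₁) (e₂ : SheafOfModules.free I₂ ≅ L₂.over U₂)
  (e₃ : SheafOfModules.free I₃ ≅ L₃.over U₃) {n₁ n₂ n₃ : ℕ} (ε₁ : I₁ ≃ Fin n₁) (ε₂ : I₂ ≃ Fin n₂)
  (ε₃ : I₃ ≃ Fin n₃) {O : XT.Opens}

include heT in
/-- **Pair transition functions on one test object MULTIPLY**: for three charts read on the same test object with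
rigidifications `ρₖ : e_T^*m_k^*L_k ≅ 𝒪_T` and the normalised isomorphisms `Ψ₁₂`, `Ψ₂₃`, `Ψ₁₃`, the wedge transition
functions satisfy `u(1,2) · u(2,3) = u(1,3)` (★ `iso_trans_eq_of_normalised` then ★ `transitionDet_wedge_mul`).
[cite: StacksProject, Tag 04TP (glueing sheaves of modules: the cocycle condition)] [cite: MumfordAV1970, §13 (p. 125)] -/
theorem transitionDet_pair_mul (hp : Function.Surjective p.appTop) (h₁ : HasRank L₁ 1)
    (ρ₁ : (Scheme.Modules.pullback eT).obj ((Scheme.Modules.pullback m₁).obj L₁) ≅ SheafOfModules.unit _)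
    (ρ₂ : (Scheme.Modules.pullback eT).obj ((Scheme.Modules.pullback m₂).obj L₂) ≅ SheafOfModules.unit _)
    (ρ₃ : (Scheme.Modules.pullback eT).obj ((Scheme.Modules.pullback m₃).obj L₃) ≅ SheafOfModules.unit _)
    (Ψ₁₂ : (Scheme.Modules.pullback m₁).obj L₁ ≅ (Scheme.Modules.pullback m₂).obj L₂)
    (Ψ₂₃ : (Scheme.Modules.pullback m₂).obj L₂ ≅ (Scheme.Modules.pullback m₃).obj L₃)
    (Ψ₁₃ : (Scheme.Modules.pullback m₁).obj L₁ ≅ (Scheme.Modules.pullback m₃).obj L₃)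
    (n₁₂ : (Scheme.Modules.pullback eT).map Ψ₁₂.hom ≫ ρ₂.hom = ρ₁.hom)
    (n₂₃ : (Scheme.Modules.pullback eT).map Ψ₂₃.hom ≫ ρ₃.hom = ρ₂.hom)
    (n₁₃ : (Scheme.Modules.pullback eT).map Ψ₁₃.hom ≫ ρ₃.hom = ρ₁.hom)
    (k₁ : O ⟶ m₁ ⁻¹ᵁ U₁) (k₂ : O ⟶ m₂ ⁻¹ᵁ U₂) (k₃ : O ⟶ m₃ ⁻¹ᵁ U₃) :
    transitionDet (pullbackFrame m₁ e₁ ≪≫ (SheafOfModules.overFunctor _ (m₁ ⁻¹ᵁ U₁)).mapIso Ψ₁₂)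
        (pullbackFrame m₂ e₂) ε₁ ε₂ k₁ k₂ *
      transitionDet (pullbackFrame m₂ e₂ ≪≫ (SheafOfModules.overFunctor _ (m₂ ⁻¹ᵁ U₂)).mapIso Ψ₂₃)
        (pullbackFrame m₃ e₃) ε₂ ε₃ k₂ k₃ =
      transitionDet (pullbackFrame m₁ e₁ ≪≫ (SheafOfModules.overFunctor _ (m₁ ⁻¹ᵁ U₁)).mapIso Ψ₁₃)
        (pullbackFrame m₃ e₃) ε₁ ε₃ k₁ k₃ :=
  transitionDet_wedge_mul m₁ m₂ m₃ e₁ e₂ e₃ ε₁ ε₂ ε₃ Ψ₁₂ Ψ₂₃ Ψ₁₃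
    (iso_trans_eq_of_normalised p eT heT hp (hasRank_pullback m₁ h₁) ρ₁ ρ₂ ρ₃ Ψ₁₂ Ψ₂₃ Ψ₁₃ n₁₂ n₂₃ n₁₃) k₁ k₂ k₃

include heT in
/-- **One chart read twice**: the normalised automorphism of `m^*L` (normalised for the same rigidification twice) is
`𝟙`, so the pair transition function of two frames `e`, `e'` of `L` is `m^♯ det T(e, e')` (★ `transitionDet_wedge_refl`).
[cite: MumfordAV1970, §13 (p. 125)] -/
theorem transitionDet_pair_self (hp : Function.Surjective p.appTop) (h₁ : HasRank L₁ 1) {U₁' : X₁.Opens}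
    {I₁' : Type u} [Fintype I₁'] {n₁' : ℕ} (e₁' : SheafOfModules.free I₁' ≅ L₁.over U₁') (ε₁' : I₁' ≃ Fin n₁')
    (ρ : (Scheme.Modules.pullback eT).obj ((Scheme.Modules.pullback m₁).obj L₁) ≅ SheafOfModules.unit _)
    (Ψ : (Scheme.Modules.pullback m₁).obj L₁ ≅ (Scheme.Modules.pullback m₁).obj L₁)
    (n : (Scheme.Modules.pullback eT).map Ψ.hom ≫ ρ.hom = ρ.hom)
    (l : O ≤ m₁ ⁻¹ᵁ (U₁ ⊓ U₁')) (k : O ⟶ m₁ ⁻¹ᵁ U₁) (k' : O ⟶ m₁ ⁻¹ᵁ U₁') :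
    transitionDet (pullbackFrame m₁ e₁ ≪≫ (SheafOfModules.overFunctor _ (m₁ ⁻¹ᵁ U₁)).mapIso Ψ)
        (pullbackFrame m₁ e₁') ε₁ ε₁' k k' =
      m₁.appLE (U₁ ⊓ U₁') O l (transitionDet e₁ e₁' ε₁ ε₁' (homOfLE inf_le_left) (homOfLE inf_le_right)) := by
  refine transitionDet_wedge_refl m₁ e₁ ε₁ e₁' ε₁' Ψ ?_ l k k'
  refine iso_eq_of_normalised p eT heT hp (hasRank_pullback m₁ h₁) ρ ρ Ψ (Iso.refl _) n ?_
  rw [Iso.refl_hom, CategoryTheory.Functor.map_id, Category.id_comp]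

end OneTestObject

/-! ### Base change along a morphism of test objects -/

section BaseChange

variable {XT T XT' T' X₁ X₂ B₁ B₂ : Scheme.{u}}
  -- the two test objects and the morphism between them
  (p : XT ⟶ T) (eT : T ⟶ XT) (p' : XT' ⟶ T') (eT' : T' ⟶ XT') (heT' : eT' ≫ p' = 𝟙 T')
  (g : XT' ⟶ XT) (t : T' ⟶ T) (sqt : eT' ≫ g = t ≫ eT)
  (υt : (Scheme.Modules.pullback t).obj (SheafOfModules.unit T.ringCatSheaf) ≅ SheafOfModules.unit T'.ringCatSheaf)
  (hυt : υt.inv.app ⊤ (1 : Γ(T', ⊤)) = unitSection t (SheafOfModules.unit T.ringCatSheaf) ⊤ (1 : Γ(T, ⊤)))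
  -- the two charts, their sections and rigidifications
  {L₁ : X₁.Modules} {L₂ : X₂.Modules} (ec₁ : B₁ ⟶ X₁) (ec₂ : B₂ ⟶ X₂)
  (r₁ : (Scheme.Modules.pullback ec₁).obj L₁ ≅ SheafOfModules.unit _)
  (r₂ : (Scheme.Modules.pullback ec₂).obj L₂ ≅ SheafOfModules.unit _)
  -- reading maps on `T` and their squares
  (m₁ : XT ⟶ X₁) (β₁ : T ⟶ B₁) (sq₁ : eT ≫ m₁ = β₁ ≫ ec₁) (m₂ : XT ⟶ X₂) (β₂ : T ⟶ B₂) (sq₂ : eT ≫ m₂ = β₂ ≫ ec₂)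
  (υ₁ : (Scheme.Modules.pullback β₁).obj (SheafOfModules.unit B₁.ringCatSheaf) ≅ SheafOfModules.unit T.ringCatSheaf)
  (hυ₁ : υ₁.inv.app ⊤ (1 : Γ(T, ⊤)) = unitSection β₁ (SheafOfModules.unit B₁.ringCatSheaf) ⊤ (1 : Γ(B₁, ⊤)))
  (υ₂ : (Scheme.Modules.pullback β₂).obj (SheafOfModules.unit B₂.ringCatSheaf) ≅ SheafOfModules.unit T.ringCatSheaf)
  (hυ₂ : υ₂.inv.app ⊤ (1 : Γ(T, ⊤)) = unitSection β₂ (SheafOfModules.unit B₂.ringCatSheaf) ⊤ (1 : Γ(B₂, ⊤)))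
  (υ₁' : (Scheme.Modules.pullback (t ≫ β₁)).obj (SheafOfModules.unit B₁.ringCatSheaf) ≅ SheafOfModules.unit T'.ringCatSheaf)
  (hυ₁' : υ₁'.inv.app ⊤ (1 : Γ(T', ⊤)) = unitSection (t ≫ β₁) (SheafOfModules.unit B₁.ringCatSheaf) ⊤ (1 : Γ(B₁, ⊤)))
  (υ₂' : (Scheme.Modules.pullback (t ≫ β₂)).obj (SheafOfModules.unit B₂.ringCatSheaf) ≅ SheafOfModules.unit T'.ringCatSheaf)
  (hυ₂' : υ₂'.inv.app ⊤ (1 : Γ(T', ⊤)) = unitSection (t ≫ β₂) (SheafOfModules.unit B₂.ringCatSheaf) ⊤ (1 : Γ(B₂, ⊤)))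
  -- frames
  {U₁ : X₁.Opens} {U₂ : X₂.Opens} {I₁ I₂ : Type u} [Fintype I₁] [Fintype I₂]
  (e₁ : SheafOfModules.free I₁ ≅ L₁.over U₁) (e₂ : SheafOfModules.free I₂ ≅ L₂.over U₂) {n₁ n₂ : ℕ}
  (ε₁ : I₁ ≃ Fin n₁) (ε₂ : I₂ ≃ Fin n₂)

include heT' hυt hυ₁ hυ₂ hυ₁' hυ₂' in
/-- **BASE CHANGE OF PAIR TRANSITION FUNCTIONS along a morphism of test objects.**  Let `Ψ : m₁^*L₁ ≅ m₂^*L₂` be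
normalised on `T` for the transported rigidifications (along the squares `e_T ≫ m_k = β_k ≫ ec_k`), and let `Ψ'` be
normalised on `T'` for the rigidifications transported DIRECTLY along the composite squares
`e_{T'} ≫ (g ≫ m_k) = (t ≫ β_k) ≫ ec_k`.  Then `g^♯` of the pair transition function of `(m₁, m₂, Ψ)` is the pair transition
function of `(g ≫ m₁, g ≫ m₂, Ψ')` (★ `transitionDet_wedge_baseChange`; the identification `g^*Ψ ~ Ψ'` is uniqueness of
normalised isomorphisms on `T'`, fed by ★ `pullback_map_normalised` and the functoriality ★ `transport_comp`).
[cite: BoschLutkebohmertRaynaud1990, §8.1 Prop. 4] [cite: StacksProject, Tag 04TP (glueing sheaves of modules)] -/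
theorem transitionDet_pair_baseChange (hp' : Function.Surjective p'.appTop) (h₁ : HasRank L₁ 1) (h₂ : HasRank L₂ 1)
    (Ψ : (Scheme.Modules.pullback m₁).obj L₁ ≅ (Scheme.Modules.pullback m₂).obj L₂)
    (n : (Scheme.Modules.pullback eT).map Ψ.hom ≫
        ((Scheme.Modules.pullbackComp eT m₂).app L₂ ≪≫ (Scheme.Modules.pullbackCongr sq₂).app L₂ ≪≫
          ((Scheme.Modules.pullbackComp β₂ ec₂).app L₂).symm ≪≫ (Scheme.Modules.pullback β₂).mapIso r₂ ≪≫ υ₂).hom =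
      ((Scheme.Modules.pullbackComp eT m₁).app L₁ ≪≫ (Scheme.Modules.pullbackCongr sq₁).app L₁ ≪≫
          ((Scheme.Modules.pullbackComp β₁ ec₁).app L₁).symm ≪≫ (Scheme.Modules.pullback β₁).mapIso r₁ ≪≫ υ₁).hom)
    (Ψ' : (Scheme.Modules.pullback (g ≫ m₁)).obj L₁ ≅ (Scheme.Modules.pullback (g ≫ m₂)).obj L₂)
    (n' : (Scheme.Modules.pullback eT').map Ψ'.hom ≫
        ((Scheme.Modules.pullbackComp eT' (g ≫ m₂)).app L₂ ≪≫
          (Scheme.Modules.pullbackCongr (sq_comp ec₂ m₂ β₂ eT sq₂ g t eT' sqt)).app L₂ ≪≫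
          ((Scheme.Modules.pullbackComp (t ≫ β₂) ec₂).app L₂).symm ≪≫ (Scheme.Modules.pullback (t ≫ β₂)).mapIso r₂ ≪≫ υ₂').hom =
      ((Scheme.Modules.pullbackComp eT' (g ≫ m₁)).app L₁ ≪≫
          (Scheme.Modules.pullbackCongr (sq_comp ec₁ m₁ β₁ eT sq₁ g t eT' sqt)).app L₁ ≪≫
          ((Scheme.Modules.pullbackComp (t ≫ β₁) ec₁).app L₁).symm ≪≫ (Scheme.Modules.pullback (t ≫ β₁)).mapIso r₁ ≪≫ υ₁').hom)
    {O : XT.Opens} (k₁ : O ⟶ m₁ ⁻¹ᵁ U₁) (k₂ : O ⟶ m₂ ⁻¹ᵁ U₂) {O' : XT'.Opens} (l : O' ≤ g ⁻¹ᵁ O)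
    (k₁' : O' ⟶ (g ≫ m₁) ⁻¹ᵁ U₁) (k₂' : O' ⟶ (g ≫ m₂) ⁻¹ᵁ U₂) :
    g.appLE O O' l
        (transitionDet (pullbackFrame m₁ e₁ ≪≫ (SheafOfModules.overFunctor _ (m₁ ⁻¹ᵁ U₁)).mapIso Ψ)
          (pullbackFrame m₂ e₂) ε₁ ε₂ k₁ k₂) =
      transitionDet (pullbackFrame (g ≫ m₁) e₁ ≪≫ (SheafOfModules.overFunctor _ ((g ≫ m₁) ⁻¹ᵁ U₁)).mapIso Ψ')
        (pullbackFrame (g ≫ m₂) e₂) ε₁ ε₂ k₁' k₂' := by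
  -- `g^*Ψ`, conjugated by the `pullbackComp`s, is an isomorphism `(g ≫ m₁)^*L₁ ≅ (g ≫ m₂)^*L₂`
  have hφ' : (Scheme.Modules.pullback g).mapIso Ψ =
      (Scheme.Modules.pullbackComp g m₁).app L₁ ≪≫
        (((Scheme.Modules.pullbackComp g m₁).app L₁).symm ≪≫ (Scheme.Modules.pullback g).mapIso Ψ ≪≫
          (Scheme.Modules.pullbackComp g m₂).app L₂) ≪≫ ((Scheme.Modules.pullbackComp g m₂).app L₂).symm := by
    rw [Iso.trans_assoc, Iso.trans_assoc, Iso.self_symm_id_assoc, Iso.self_symm_id, Iso.trans_refl]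
  rw [transitionDet_wedge_baseChange m₁ m₂ e₁ e₂ ε₁ ε₂ g Ψ _ hφ' k₁ k₂ l k₁' k₂']
  -- and it is normalised on `T'` for the directly transported rigidifications, hence equals `Ψ'`
  suffices hφΨ : ((Scheme.Modules.pullbackComp g m₁).app L₁).symm ≪≫ (Scheme.Modules.pullback g).mapIso Ψ ≪≫
      (Scheme.Modules.pullbackComp g m₂).app L₂ = Ψ' by rw [hφΨ]
  refine iso_eq_of_normalised p' eT' heT' hp' (hasRank_pullback (g ≫ m₁) h₁) _ _ _ Ψ' ?_ n'
  -- the directly transported rigidifications are the two-step transports (★ `transport_comp`)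
  rw [transport_comp ec₁ m₁ β₁ eT sq₁ g t eT' sqt υ₁ hυ₁ υt hυt υ₁' hυ₁' h₁ r₁,
    transport_comp ec₂ m₂ β₂ eT sq₂ g t eT' sqt υ₂ hυ₂ υt hυt υ₂' hυ₂' h₂ r₂]
  -- and `g^*Ψ` is normalised for the two-step transports (★ `pullback_map_normalised`)
  have key := pullback_map_normalised eT g t eT' sqt υt _ _ Ψ n
  simp only [Iso.trans_hom, Iso.symm_hom, Functor.mapIso_hom, Functor.map_comp, Category.assoc] at key ⊢
  rw [← key, ← (Scheme.Modules.pullback eT').map_comp_assoc ((Scheme.Modules.pullbackComp g m₂).app L₂).hom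
      ((Scheme.Modules.pullbackComp g m₂).app L₂).inv, Iso.hom_inv_id, CategoryTheory.Functor.map_id,
    Category.id_comp]

include hυ₁ hυ₂ in
/-- **Pair transition functions depend only on the reading maps**: along propositionally equal reading maps and squares
(the rigidifications being the transports, the isomorphisms THE normalised ones), they agree.
[cite: StacksProject, Tag 04TP (glueing sheaves of modules)] -/
theorem transitionDet_pair_congr (heT : eT ≫ p = 𝟙 T) (hp : Function.Surjective p.appTop) (h₁ : HasRank L₁ 1)
    {m₁' : XT ⟶ X₁} {β₁' : T ⟶ B₁} {m₂' : XT ⟶ X₂} {β₂' : T ⟶ B₂} (hm₁ : m₁ = m₁') (hβ₁ : β₁ = β₁') (hm₂ : m₂ = m₂')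
    (hβ₂ : β₂ = β₂') (sq₁' : eT ≫ m₁' = β₁' ≫ ec₁) (sq₂' : eT ≫ m₂' = β₂' ≫ ec₂)
    (υa : (Scheme.Modules.pullback β₁').obj (SheafOfModules.unit B₁.ringCatSheaf) ≅ SheafOfModules.unit T.ringCatSheaf)
    (hυa : υa.inv.app ⊤ (1 : Γ(T, ⊤)) = unitSection β₁' (SheafOfModules.unit B₁.ringCatSheaf) ⊤ (1 : Γ(B₁, ⊤)))
    (υb : (Scheme.Modules.pullback β₂').obj (SheafOfModules.unit B₂.ringCatSheaf) ≅ SheafOfModules.unit T.ringCatSheaf)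
    (hυb : υb.inv.app ⊤ (1 : Γ(T, ⊤)) = unitSection β₂' (SheafOfModules.unit B₂.ringCatSheaf) ⊤ (1 : Γ(B₂, ⊤)))
    (Ψ : (Scheme.Modules.pullback m₁).obj L₁ ≅ (Scheme.Modules.pullback m₂).obj L₂)
    (n : (Scheme.Modules.pullback eT).map Ψ.hom ≫
        ((Scheme.Modules.pullbackComp eT m₂).app L₂ ≪≫ (Scheme.Modules.pullbackCongr sq₂).app L₂ ≪≫
          ((Scheme.Modules.pullbackComp β₂ ec₂).app L₂).symm ≪≫ (Scheme.Modules.pullback β₂).mapIso r₂ ≪≫ υ₂).hom =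
      ((Scheme.Modules.pullbackComp eT m₁).app L₁ ≪≫ (Scheme.Modules.pullbackCongr sq₁).app L₁ ≪≫
          ((Scheme.Modules.pullbackComp β₁ ec₁).app L₁).symm ≪≫ (Scheme.Modules.pullback β₁).mapIso r₁ ≪≫ υ₁).hom)
    (Ψ' : (Scheme.Modules.pullback m₁').obj L₁ ≅ (Scheme.Modules.pullback m₂').obj L₂)
    (n' : (Scheme.Modules.pullback eT).map Ψ'.hom ≫
        ((Scheme.Modules.pullbackComp eT m₂').app L₂ ≪≫ (Scheme.Modules.pullbackCongr sq₂').app L₂ ≪≫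
          ((Scheme.Modules.pullbackComp β₂' ec₂).app L₂).symm ≪≫ (Scheme.Modules.pullback β₂').mapIso r₂ ≪≫ υb).hom =
      ((Scheme.Modules.pullbackComp eT m₁').app L₁ ≪≫ (Scheme.Modules.pullbackCongr sq₁').app L₁ ≪≫
          ((Scheme.Modules.pullbackComp β₁' ec₁).app L₁).symm ≪≫ (Scheme.Modules.pullback β₁').mapIso r₁ ≪≫ υa).hom)
    {O : XT.Opens} (k₁ : O ⟶ m₁ ⁻¹ᵁ U₁) (k₂ : O ⟶ m₂ ⁻¹ᵁ U₂) (k₁' : O ⟶ m₁' ⁻¹ᵁ U₁) (k₂' : O ⟶ m₂' ⁻¹ᵁ U₂) :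
    transitionDet (pullbackFrame m₁ e₁ ≪≫ (SheafOfModules.overFunctor _ (m₁ ⁻¹ᵁ U₁)).mapIso Ψ)
        (pullbackFrame m₂ e₂) ε₁ ε₂ k₁ k₂ =
      transitionDet (pullbackFrame m₁' e₁ ≪≫ (SheafOfModules.overFunctor _ (m₁' ⁻¹ᵁ U₁)).mapIso Ψ')
        (pullbackFrame m₂' e₂) ε₁ ε₂ k₁' k₂' := by
  subst hm₁ hβ₁ hm₂ hβ₂
  -- the identifications `υ` of `β^*𝒪` with `𝒪` are unique (their inverses send `1` to `η_β(1)`)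
  obtain rfl : υa = υ₁ := iso_unit_eq_of_inv_app_top_one υa υ₁ (hυa.trans hυ₁.symm)
  obtain rfl : υb = υ₂ := iso_unit_eq_of_inv_app_top_one υb υ₂ (hυb.trans hυ₂.symm)
  obtain rfl : Ψ = Ψ' := iso_eq_of_normalised p eT heT hp (hasRank_pullback m₁ h₁) _ _ Ψ Ψ' n n'
  exact transitionDet_congr_hom _ _ ε₁ ε₂ _ _ _ _

end BaseChange

end Literature.AlgebraicGeometry.Modules

end
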